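import Summits.AtomisticToContinuum.BoseEinsteinCondensation.Theorems.BECInsertionCorrectorCorrectorClosureFlatDomination
import Summits.AtomisticToContinuum.BoseEinsteinCondensation.Theorems.BECInsertionCorrectorCorrectorClosureFidelityLimit
import Literature.MathematicalPhysics.QuantumManyBody.PeriodicFeynmanKacSymmetry
import HarnessLib

/-!
# Log-convexity of the flat insertion partition function (line `residue-area-law`,
# sub-goal `flatPartition_sq_le_mul`)

Crux `BECInsertionCorrector.CorrectorClosure` (item stmt-AtomisticToContinuum-12058), line
`residue-area-law`, sub-goal `flatPartition_sq_le_mul`.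

Fix `N`, a box `L > 0` and a measurable pair potential `v ≥ 0`. Let `Θ₀ : Config N → ℝ` be the
`N`-body torus Feynman–Kac ground state (`IsPeriodicGroundStateFK v L Θ₀`) and add one particle
FLAT, `ψ X = ofReal (Θ₀ (vecTail X))` on `Config (N + 1)`. The flat insertion partition function is
`Z t = ∫⁻_{cellN (N+1) L} ψ · T_t ψ` with `T_t = periodicFKSemigroup v L t`. We prove the basic
structural fact that `log Z` is midpoint-convex,

  `Z (s + t) ^ 2 ≤ Z (2s) · Z (2t)`  (`s, t ≥ 0`),

by the Markov property `T_{s+t} = T_s T_t` (`periodicFKSemigroup_add`), the symmetry of `T_s` on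
the cell for periodic data (`setLIntegral_cellN_mul_periodicFKSemigroup_comm`), which together give
`Z (s + t) = ∫⁻_cell T_t ψ · T_s ψ` and `Z (2s) = ∫⁻_cell (T_s ψ)²`, and Cauchy–Schwarz for lower
integrals (`lintegral_mul_sq_le` of `SwapPurity.lean`). Corollaries: the doubling quotient
`D(t) = Z(2t)Z(0)/Z(t)²` is `≥ 1` (`Z t ^ 2 ≤ Z (2t) · Z 0`), and the dyadic ledger increments are
nonnegative, `D(2T) ≥ D(T)`, i.e. `Z (2T) ^ 3 ≤ Z (4T) · Z T ^ 2` (cancel one factor `Z (2T)`,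
finite by `stub_flatDomination`). Fixed `N`, `L`; every measurable `v`; no spectral theory.
-/

noncomputable section

open MeasureTheory Filter Matrix
open scoped ENNReal NNReal BigOperators

namespace Summit.AtomisticToContinuum.BoseEinsteinCondensation.Theorems.CorrectorClosure.ResidueAreaLaw

open Literature.MathematicalPhysics.QuantumManyBody.BoseGas

variable {N : ℕ}

/-! ### Markov property and symmetry on the cell -/

/-- **`⟨g, T_{s+t} g⟩_cell = ⟨T_t g, T_s g⟩_cell`** for periodic measurable `g ≥ 0` and `s, t ≥ 0`:
the semigroup law `T_{s+t} g = T_s (T_t g)` followed by the symmetry of `T_s` on the cell (the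
functional `T_t g` of the periodic datum is again periodic and measurable). [folklore] -/
theorem flc_setLIntegral_mul_periodicFKSemigroup_add {M : ℕ} {v : ℝ → ℝ≥0∞} (hv : Measurable v)
    {L : ℝ} (hL : 0 < L) {g : Config M → ℝ≥0∞} (hg : Measurable g)
    (hgper : ∀ (X : Config M) (i : Fin M) (k : Fin 3),
      g (X + Pi.single i (EuclideanSpace.single k L)) = g X)
    {s t : ℝ} (hs : 0 ≤ s) (ht : 0 ≤ t) :
    ∫⁻ X in cellN M L, g X * periodicFKSemigroup v L (s + t) g X =
      ∫⁻ X in cellN M L, periodicFKSemigroup v L t g X * periodicFKSemigroup v L s g X :=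
  calc ∫⁻ X in cellN M L, g X * periodicFKSemigroup v L (s + t) g X
      = ∫⁻ X in cellN M L, g X * periodicFKSemigroup v L s (periodicFKSemigroup v L t g) X :=
        lintegral_congr fun X => by rw [periodicFKSemigroup_add hv L hs ht hg X]
    _ = ∫⁻ X in cellN M L, periodicFKSemigroup v L t g X * periodicFKSemigroup v L s g X :=
        setLIntegral_cellN_mul_periodicFKSemigroup_comm hv hL hs hg
          (measurable_periodicFKSemigroup hv L t hg) hgper
          (fun X i k => periodicFKSemigroup_add_single_of_periodic v L t hgper X i k)

/-- **`⟨g, T_{2s} g⟩_cell = ‖T_s g‖²_cell`** for periodic measurable `g ≥ 0` and `s ≥ 0`.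
[folklore] -/
theorem flc_setLIntegral_mul_periodicFKSemigroup_two_mul {M : ℕ} {v : ℝ → ℝ≥0∞}
    (hv : Measurable v) {L : ℝ} (hL : 0 < L) {g : Config M → ℝ≥0∞} (hg : Measurable g)
    (hgper : ∀ (X : Config M) (i : Fin M) (k : Fin 3),
      g (X + Pi.single i (EuclideanSpace.single k L)) = g X)
    {s : ℝ} (hs : 0 ≤ s) :
    ∫⁻ X in cellN M L, g X * periodicFKSemigroup v L (2 * s) g X =
      ∫⁻ X in cellN M L, periodicFKSemigroup v L s g X ^ 2 := by
  rw [two_mul, flc_setLIntegral_mul_periodicFKSemigroup_add hv hL hg hgper hs hs]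
  exact lintegral_congr fun X => (sq _).symm

/-- **Midpoint log-convexity of `t ↦ ⟨g, T_t g⟩_cell`** for periodic measurable `g ≥ 0`:
`⟨g, T_{s+t} g⟩² ≤ ⟨g, T_{2s} g⟩ · ⟨g, T_{2t} g⟩` (`s, t ≥ 0`), i.e.
`⟨T_t g, T_s g⟩² ≤ ‖T_s g‖² ‖T_t g‖²` — Cauchy–Schwarz on the cell. [folklore] -/
theorem flc_sq_le_mul {M : ℕ} {v : ℝ → ℝ≥0∞} (hv : Measurable v) {L : ℝ} (hL : 0 < L)
    {g : Config M → ℝ≥0∞} (hg : Measurable g)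
    (hgper : ∀ (X : Config M) (i : Fin M) (k : Fin 3),
      g (X + Pi.single i (EuclideanSpace.single k L)) = g X)
    {s t : ℝ} (hs : 0 ≤ s) (ht : 0 ≤ t) :
    (∫⁻ X in cellN M L, g X * periodicFKSemigroup v L (s + t) g X) ^ 2 ≤
      (∫⁻ X in cellN M L, g X * periodicFKSemigroup v L (2 * s) g X) *
        ∫⁻ X in cellN M L, g X * periodicFKSemigroup v L (2 * t) g X := by
  rw [flc_setLIntegral_mul_periodicFKSemigroup_add hv hL hg hgper hs ht,
    flc_setLIntegral_mul_periodicFKSemigroup_two_mul hv hL hg hgper hs,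
    flc_setLIntegral_mul_periodicFKSemigroup_two_mul hv hL hg hgper ht]
  exact (lintegral_mul_sq_le _ (measurable_periodicFKSemigroup hv L t hg).aemeasurable
    (measurable_periodicFKSemigroup hv L s hg).aemeasurable).trans_eq (mul_comm _ _)

/-! ### The sub-goal and its corollaries -/

/-- **Sub-goal `flatPartition_sq_le_mul` of line `residue-area-law` — `log 𝒵` is midpoint-convex:
`𝒵(s+t)² ≤ 𝒵(2s)·𝒵(2t)` for `s, t ≥ 0`** (fixed `N`, `L > 0`, every measurable `v`). With
`ψ = ofReal ∘ Θ₀ ∘ vecTail` (measurable, and `Lℤ³`-periodic in every particle of `Config (N + 1)`,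
`fid_tail_periodic`) and `𝒵(t) = ∫⁻_cell ψ · T_t ψ`: the Markov property `T_{s+t} = T_s T_t` and the
symmetry of `T_s` on the cell give `𝒵(s+t) = ⟨T_t ψ, T_s ψ⟩_cell` and `𝒵(2s) = ‖T_s ψ‖²_cell`, and
Cauchy–Schwarz concludes. [folklore] -/
theorem flatPartition_sq_le_mul (v : ℝ → ℝ≥0∞) (hv : Measurable v) (N : ℕ) (L : ℝ) (hL : 0 < L)
    (Θ₀ : Config N → ℝ) (hΘ : IsPeriodicGroundStateFK v L Θ₀) (Z : ℝ → ℝ≥0∞)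
    (hZ : Z = fun t => ∫⁻ X in cellN (N + 1) L, ENNReal.ofReal (Θ₀ (vecTail X)) *
      periodicFKSemigroup v L t (fun Y => ENNReal.ofReal (Θ₀ (vecTail Y))) X)
    (s t : ℝ) (hs : 0 ≤ s) (ht : 0 ≤ t) :
    Z (s + t) ^ 2 ≤ Z (2 * s) * Z (2 * t) := by
  subst hZ
  exact flc_sq_le_mul (g := fun Y => ENNReal.ofReal (Θ₀ (vecTail Y))) hv hL
    ((ENNReal.measurable_ofReal.comp hΘ.measurable).comp measurable_vecTail)
    (fid_tail_periodic hΘ.periodic) hs ht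

/-- `D(t) ≥ 1`: `Z t ^ 2 ≤ Z (2 * t) * Z 0` for `t ≥ 0` (the main lemma at `(s, t) := (t, 0)`).
[folklore] -/
theorem flatPartition_sq_le_doubling (v : ℝ → ℝ≥0∞) (hv : Measurable v) (N : ℕ) (L : ℝ)
    (hL : 0 < L) (Θ₀ : Config N → ℝ) (hΘ : IsPeriodicGroundStateFK v L Θ₀) (Z : ℝ → ℝ≥0∞)
    (hZ : Z = fun t => ∫⁻ X in cellN (N + 1) L, ENNReal.ofReal (Θ₀ (vecTail X)) *
      periodicFKSemigroup v L t (fun Y => ENNReal.ofReal (Θ₀ (vecTail Y))) X)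
    (t : ℝ) (ht : 0 ≤ t) : Z t ^ 2 ≤ Z (2 * t) * Z 0 := by
  have h := flatPartition_sq_le_mul v hv N L hL Θ₀ hΘ Z hZ t 0 ht le_rfl
  rwa [add_zero, mul_zero] at h

/-- Nonnegativity of the dyadic ledger increments (`D(2T) ≥ D(T)`): `Z (2T)^3 ≤ Z (4T) * Z T ^ 2`,
`T ≥ 0` (square `Z(2T)² ≤ Z(3T)Z(T)`, use `Z(3T)² ≤ Z(4T)Z(2T)`, cancel one finite factor `Z(2T)`).
[folklore] -/
theorem flatPartition_cube_le (v : ℝ → ℝ≥0∞) (hv : Measurable v) (N : ℕ) (L : ℝ) (hL : 0 < L)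
    (Θ₀ : Config N → ℝ) (hΘ : IsPeriodicGroundStateFK v L Θ₀) (Z : ℝ → ℝ≥0∞)
    (hZ : Z = fun t => ∫⁻ X in cellN (N + 1) L, ENNReal.ofReal (Θ₀ (vecTail X)) *
      periodicFKSemigroup v L t (fun Y => ENNReal.ofReal (Θ₀ (vecTail Y))) X)
    (T : ℝ) (hT : 0 ≤ T) : Z (2 * T) ^ 3 ≤ Z (4 * T) * Z T ^ 2 := by
  -- `Z(2T)² ≤ Z(3T) Z(T)` from `(s, t) = (3T/2, T/2)`
  have h1 : Z (2 * T) ^ 2 ≤ Z (3 * T) * Z T := by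
    have h := flatPartition_sq_le_mul v hv N L hL Θ₀ hΘ Z hZ (3 * T / 2) (T / 2)
      (by positivity) (by positivity)
    have e1 : 3 * T / 2 + T / 2 = 2 * T := by ring
    have e2 : 2 * (3 * T / 2) = 3 * T := by ring
    have e3 : 2 * (T / 2) = T := by ring
    rwa [e1, e2, e3] at h
  -- `Z(3T)² ≤ Z(4T) Z(2T)` from `(s, t) = (2T, T)`
  have h2 : Z (3 * T) ^ 2 ≤ Z (4 * T) * Z (2 * T) := by
    have h := flatPartition_sq_le_mul v hv N L hL Θ₀ hΘ Z hZ (2 * T) T (by positivity) hT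
    have e1 : 2 * T + T = 3 * T := by ring
    have e2 : 2 * (2 * T) = 4 * T := by ring
    rwa [e1, e2] at h
  -- `Z(2T)⁴ ≤ Z(3T)² Z(T)² ≤ Z(4T) Z(T)² Z(2T)`
  have h4 : Z (2 * T) ^ 3 * Z (2 * T) ≤ Z (4 * T) * Z T ^ 2 * Z (2 * T) :=
    calc Z (2 * T) ^ 3 * Z (2 * T) = (Z (2 * T) ^ 2) ^ 2 := by ring
      _ ≤ (Z (3 * T) * Z T) ^ 2 := pow_le_pow_left' h1 2
      _ = Z (3 * T) ^ 2 * Z T ^ 2 := mul_pow _ _ 2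
      _ ≤ Z (4 * T) * Z (2 * T) * Z T ^ 2 := mul_le_mul' h2 le_rfl
      _ = Z (4 * T) * Z T ^ 2 * Z (2 * T) := by ring
  -- cancel one (finite) factor `Z(2T)`; the case `Z(2T) = 0` is trivial
  by_cases h0 : Z (2 * T) = 0
  · rw [h0, zero_pow three_ne_zero]
    exact zero_le
  · have hne : Z (2 * T) ≠ ⊤ :=
      ne_top_of_le_ne_top ENNReal.ofReal_ne_top
        ((stub_flatDomination v hv N L hL Θ₀ hΘ Z hZ).2 (2 * T) (by positivity))
    exact (ENNReal.mul_le_mul_iff_left h0 hne).1 h4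

end Summit.AtomisticToContinuum.BoseEinsteinCondensation.Theorems.CorrectorClosure.ResidueAreaLaw

end
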